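import Summits.QuantumFields.YangMills.Theorems.AllWindowsColdBoxBoxHighLineBoxToChartReductionCore
import Summits.QuantumFields.YangMills.Theorems.AllWindowsColdBoxBoxHighLineLandauClosers
import Summits.QuantumFields.YangMills.Theorems.AllWindowsColdBoxBoxHighLineLandauRepresentativeStrong

/-!
# RARITY BOOTSTRAP — a coarse plaquette-rarity bound feeds a finer one through the FP small-field chain (Steps A+B+C of ASSEMBLY-S5)
# (lift L5+ «rarity entropy» of `Cruxes/BoxWindowHighSU2213/U5-BLOCKERS.md` §2, by name; LINE-20 U5 ⟨stmt-QuantumFields-24336⟩, LINE-19 S5 ⟨24004⟩/⟨24335⟩)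

Width seat `ym-line-sfw-p2-w5` (prover-ym-line-sfw-p2-w5-g23-0).  w2 g31's ✓`BoxToChart.abs_boxState_sub_smallField_ratio_le` bounds, for EVERY
gauge-invariant measurable observable `0 ≤ G ≤ 1`, `|E_box G − ⟨G⟩_D| ≤ 4δ + 4·P_box(¬SP(spl)) + 2τ` (FP representation at the plaquette threshold `spl`
with Landau radius `r₀`, orbit-normaliser precision `δ`, small-field mass `τ` of `D = smallField H s` inside the FP weight).  Take
`G := 1 − spIndicator H spl′` — the indicator of `¬SmallPlaquettes H spl′` at a FINER threshold `spl′` with `17·s² ≤ spl′²`: by ✓LEMMA 6s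
`smallFieldSmallPlaquettes` the configuration `edgeChart H a` of every `a ∈ D` has small plaquettes at level `spl′`, so `G ∘ edgeChart = 0` on `D`,
`⟨G⟩_D = 0`, and

* ★ `boxState_not_smallPlaquettes_bootstrap` — `P_box(¬SP(spl′)) ≤ 4δ + 4·P_box(¬SP(spl)) + 2τ` (hypotheses VERBATIM those of
  ✓`abs_boxState_sub_smallField_ratio_le`, plus `17·s² ≤ spl′²`);
* ★ `boxState_not_smallPlaquettes_bootstrap_window (h4b : LandauBootstrapBound)` — (i)/(ii) discharged in the ✓T-S5.4J window exactly as in w2's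
  ✓`boxPlaqCov_sub_chartCov_le_window` (`δ = e^{−cH⁴}`, `r₀ = √C₄b·H(1+log H)²·spl`);
* ★ `boxState_not_smallPlaquettes_bootstrap_window'` — with S4b := ✓`stub_landauRepresentative`;
* ★ `…_window_strong (hU2 : LandauRepresentativeBound)` / `…_window_strong'` (U2 := ✓`stub_landauRepresentativeStrong`) — LINE-20 letters:
  premise `spl·H³·(1+log H) ≤ c₀`, radius `√C_U2·H·(1+log H)·spl`, so the bootstrap START (`ε₀ > 2θ`) is admissible for every `θ < 1/10` (planner 22:16:43Z).

Why it matters (exponents, `H = β^θ`, `spl = β^{ε₀−1/2}`, `spl′ = β^{ε₁−1/2}`, `τ = C H⁴exp(C r H⁵ − cβs²)` from ✓T-S5.6 with `s = spl′/5`,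
`r ≈ r₀`): the step is affordable iff `6θ + ε₀ − 1/2 < 2ε₁`; starting from the free-threshold Gibbs rarity (✓`exists_forall_boxState_not_smallPlaquettes_le`,
`ε₀ > 2θ`) and ITERATING, the admissible `ε₁` decreases to any `ε₁ > (6θ − 1/2)⁺` (`(5θ − 1/2)⁺` with the sharpened T-S5.6′ of `TaskU5L5`):
the rarity-entropy constraint (c) `ε₁ > 2θ` of ASSEMBLY-S5 v13 disappears for `θ < 1/12` without new analysis.  The remaining limits are the
FP window (B1, `12θ < 1`, lifted by L1∞) and S4b's premise `spl·H⁴(1+log H)² ≤ c₀` at the START (needs `ε₀ < 1/2 − 4θ`, compatible with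
`ε₀ > 2θ` iff `θ < 1/12`) — see the design memo `ym-idea-1/w5-g23-L5plus-DESIGN.md`.

Everything proved, tree only; no definitions; standard axioms.  HONEST LABEL: by-name plumbing for the recorded, unstaffed lift L5+ of the NEXT rung U5 of a
critic-PASSed DRAFT line; S5/T-S5.13, U5, ⟨24004⟩ ⟨24335⟩ ⟨24336⟩ remain OPEN; no crux, rung or summit is proved; **the Yang–Mills mass gap is NOT proved by
this file; no summit is proved by a line.**
-/

set_option autoImplicit false

noncomputable section

open MeasureTheory
open Literature.Probability.LatticeModels (Site)
open Literature.MathematicalPhysics.QuantumFieldTheory.AxialGauge (boxEdges)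
open Literature.MathematicalPhysics.QuantumLattice (LGConfig gaugeTransformZd fundamentalRep)
open Summit.QuantumFields.YangMills.Theorems.WeakCouplingRates (boxState)

namespace Summit.QuantumFields.YangMills.Theorems.AllWindowsColdBoxBoxHighLine

open FPRep

namespace BoxToChart

variable {H : ℕ}

/-- The indicator of `¬SmallPlaquettes H spl′` as `1 − spIndicator`: gauge invariant, measurable, valued in `[0,1]`. -/
theorem one_sub_spIndicator_props (H : ℕ) (spl' : ℝ) :
    (∀ g : InteriorGauge H, ∀ U : LGConfig 4 SU2,
        (fun U => 1 - spIndicator H spl' U) (gaugeTransformZd (extendGauge H g) U) = (fun U => 1 - spIndicator H spl' U) U) ∧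
      Measurable (fun U : LGConfig 4 SU2 => 1 - spIndicator H spl' U) ∧
      (∀ U : LGConfig 4 SU2, 0 ≤ 1 - spIndicator H spl' U) ∧ (∀ U : LGConfig 4 SU2, 1 - spIndicator H spl' U ≤ 1) := by
  refine ⟨fun g U => by simp only [spIndicator_gaugeTransformZd], measurable_const.sub (measurable_spIndicator H spl'),
    fun U => ?_, fun U => ?_⟩
  · have := (spIndicator_mem_Icc H spl' U).2; linarith
  · have := (spIndicator_mem_Icc H spl' U).1; linarith

/-- `E_box[1 − spIndicator spl′] = P_box(¬SP(spl′))`. -/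
theorem integral_one_sub_spIndicator_eq (β : ℝ) (H : ℕ) (spl' : ℝ) :
    (∫ U, (1 - spIndicator H spl' U) ∂(boxState (fundamentalRep (Fin 2)) β H)) =
      ((boxState (fundamentalRep (Fin 2)) β H) {U | ¬ SmallPlaquettes H spl' U}).toReal := by
  have hfun : (fun U : LGConfig 4 SU2 => 1 - spIndicator H spl' U) = {U | ¬ SmallPlaquettes H spl' U}.indicator fun _ => (1 : ℝ) := by
    funext U
    by_cases hU : SmallPlaquettes H spl' U
    · have hn : U ∉ {U | ¬ SmallPlaquettes H spl' U} := fun h => h hU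
      rw [spIndicator_of_mem hU, Set.indicator_of_notMem hn, sub_self]
    · have hm : U ∈ {U | ¬ SmallPlaquettes H spl' U} := hU
      rw [spIndicator_of_not_mem hU, Set.indicator_of_mem hm, sub_zero]
  have hmeas : MeasurableSet {U : LGConfig 4 SU2 | ¬ SmallPlaquettes H spl' U} := (measurableSet_smallPlaquettes H spl').compl
  rw [hfun, integral_indicator hmeas, setIntegral_const, smul_eq_mul, mul_one, measureReal_def]

/-- ★ **Rarity bootstrap, core.**  Under the hypotheses of ✓`abs_boxState_sub_smallField_ratio_le` (Landau representative of radius `r₀` on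
`ColdWall ∩ SP(spl)`, orbit-normaliser precision `δ ≤ 1/2`, small field `0 ≤ s ≤ 1/100` with `17s² ≤ spl²`, small-field mass `τ` inside the FP weight)
and `17·s² ≤ spl′²`:  `P_box(¬SP(spl′)) ≤ 4δ + 4·P_box(¬SP(spl)) + 2τ`. -/
theorem boxState_not_smallPlaquettes_bootstrap (hH : 1 ≤ H) {β r r₀ spl spl' s δ τ : ℝ} (hβ : 0 < β) (hδ0 : 0 ≤ δ) (hδ : δ ≤ 1 / 2)
    (hrep : ∀ U : LGConfig 4 SU2, ColdWall H U → SmallPlaquettes H spl U →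
        ∃ g : Site 4 → SU2, IsInteriorGauge H g ∧ InLandauGauge H (gaugeTransformZd g U) ∧
          ∀ e ∈ boxEdges 4 (2 * H + 1), linkDefect (gaugeTransformZd g U) e ≤ r₀ ^ 2)
    (hN : ∀ V : LGConfig 4 SU2, InLandauGauge H V → (∀ e ∈ boxEdges 4 (2 * H + 1), linkDefect V e ≤ r₀ ^ 2) →
        |orbitAverage H (jacWeight β H r) V / laplaceZ0 β H - 1| ≤ δ)
    (hs0 : 0 ≤ s) (hs1 : s ≤ 1 / 100) (hspl : 17 * s ^ 2 ≤ spl ^ 2) (hspl' : 17 * s ^ 2 ≤ spl' ^ 2) (hτ0 : 0 ≤ τ)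
    (hτ : ∫ a in chartDomain H \ smallField H s, fpChartWeight β H r a ≤ τ * ∫ a in smallField H (s / 2), fpChartWeight β H r a) :
    ((boxState (fundamentalRep (Fin 2)) β H) {U | ¬ SmallPlaquettes H spl' U}).toReal ≤
      4 * δ + 4 * ((boxState (fundamentalRep (Fin 2)) β H) {U | ¬ SmallPlaquettes H spl U}).toReal + 2 * τ := by
  obtain ⟨hGinv, hGm, hG0, hG1⟩ := one_sub_spIndicator_props H spl'
  have h := abs_boxState_sub_smallField_ratio_le hH hβ hδ0 hδ hrep hN hs0 hs1 hspl hτ0 hτ hGinv hGm hG0 hG1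
  -- the numerator on `D` vanishes: small field ⊆ small plaquettes at level `spl′`
  have hD : (∫ a in smallField H s, (1 - spIndicator H spl' (edgeChart H a)) * fpChartWeight β H r a) = 0 := by
    refine setIntegral_eq_zero_of_forall_eq_zero fun a ha => ?_
    have hsp : SmallPlaquettes H spl' (edgeChart H a) := smallFieldSmallPlaquettes H s spl' hs0 hs1 hspl' a ha
    rw [spIndicator_of_mem hsp, sub_self, zero_mul]
  rw [hD, zero_div, sub_zero, integral_one_sub_spIndicator_eq] at h
  exact (le_abs_self _).trans h

/-- ★ **Rarity bootstrap in the ✓T-S5.4J window, S4b as the only structural hypothesis** ((i) = `LandauBootstrapBound` at `(H, spl, r₀)`,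
(ii) = ✓`orbitNormaliserJacobianR` at `(H, β, r₀, r)`, `δ = e^{−cH⁴}`; binders as in w2's ✓`boxPlaqCov_sub_chartCov_le_window` plus `spl′`). -/
theorem boxState_not_smallPlaquettes_bootstrap_window (h4b : LandauBootstrapBound) :
    ∃ K C c c₀ : ℝ, 0 < K ∧ 0 < C ∧ 0 < c ∧ 0 < c₀ ∧ ∀ H : ℕ, 1 ≤ H → ∀ (β spl spl' r s τ : ℝ), 2 ≤ β →
      C * (H : ℝ) ^ 12 * (1 + Real.log β) ^ 8 ≤ β → Real.exp (-(c * (H : ℝ) ^ 4)) ≤ 1 / 2 →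
      0 ≤ spl → spl * (H : ℝ) ^ 4 * (1 + Real.log H) ^ 2 ≤ c₀ →
      C * (K * H * (1 + Real.log H) ^ 2 * spl) * (H : ℝ) ^ 2 ≤ 1 →
      K * H * (1 + Real.log H) ^ 2 * spl + 1 / ((H : ℝ) ^ 4 * (1 + Real.log β) ^ 2) ≤ r → C * r * H ≤ 1 →
      0 ≤ s → s ≤ 1 / 100 → 17 * s ^ 2 ≤ spl ^ 2 → 17 * s ^ 2 ≤ spl' ^ 2 → 0 ≤ τ →
      (∫ a in chartDomain H \ smallField H s, fpChartWeight β H r a ≤ τ * ∫ a in smallField H (s / 2), fpChartWeight β H r a) →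
      ((boxState (fundamentalRep (Fin 2)) β H) {U | ¬ SmallPlaquettes H spl' U}).toReal ≤
        4 * Real.exp (-(c * (H : ℝ) ^ 4)) + 4 * ((boxState (fundamentalRep (Fin 2)) β H) {U | ¬ SmallPlaquettes H spl U}).toReal + 2 * τ := by
  obtain ⟨C₄, c₀, hC₄, hc₀, h4⟩ := h4b
  obtain ⟨C, c, hC, hc, hR⟩ := orbitNormaliserJacobianR
  refine ⟨Real.sqrt C₄, C, c, c₀, Real.sqrt_pos.2 hC₄, hC, hc, hc₀, ?_⟩
  intro H hH β spl spl' r s τ hβ hwin hδ hspl hprem hr₀C hgap hrC hs0 hs1 hspls hspls' hτ0 hτ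
  set r₀ : ℝ := Real.sqrt C₄ * H * (1 + Real.log H) ^ 2 * spl with hr₀
  have hHr : (1 : ℝ) ≤ (H : ℝ) := by exact_mod_cast hH
  have hlogH : 0 ≤ 1 + Real.log (H : ℝ) := by linarith [Real.log_nonneg hHr]
  have hr₀0 : 0 ≤ r₀ := by rw [hr₀]; positivity
  have hr₀sq : r₀ ^ 2 = C₄ * (H : ℝ) ^ 2 * (1 + Real.log H) ^ 4 * spl ^ 2 := by
    rw [hr₀]
    have := Real.sq_sqrt hC₄.le
    ring_nf
    rw [this]
    ring
  refine boxState_not_smallPlaquettes_bootstrap hH (r₀ := r₀) (by linarith) (Real.exp_pos _).le hδ ?_ ?_ hs0 hs1 hspls hspls' hτ0 hτ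
  · -- (i) the Landau representative from S4b
    intro U hU hsp
    obtain ⟨g, hg, hL, hlinks⟩ := h4 H hH spl hspl hprem U hU hsp
    exact ⟨g, hg, hL, fun e he => (hlinks e he).trans_eq hr₀sq.symm⟩
  · -- (ii) the orbit-normaliser precision from T-S5.4J
    intro V hV hlinks
    exact hR H hH β r₀ r hβ hwin hr₀0 hr₀C hgap hrC V hV hlinks

/-- ★ **Rarity bootstrap in the ✓T-S5.4J window, unconditional structural input** (S4b = ✓`stub_landauRepresentative`). -/
theorem boxState_not_smallPlaquettes_bootstrap_window' :
    ∃ K C c c₀ : ℝ, 0 < K ∧ 0 < C ∧ 0 < c ∧ 0 < c₀ ∧ ∀ H : ℕ, 1 ≤ H → ∀ (β spl spl' r s τ : ℝ), 2 ≤ β →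
      C * (H : ℝ) ^ 12 * (1 + Real.log β) ^ 8 ≤ β → Real.exp (-(c * (H : ℝ) ^ 4)) ≤ 1 / 2 →
      0 ≤ spl → spl * (H : ℝ) ^ 4 * (1 + Real.log H) ^ 2 ≤ c₀ →
      C * (K * H * (1 + Real.log H) ^ 2 * spl) * (H : ℝ) ^ 2 ≤ 1 →
      K * H * (1 + Real.log H) ^ 2 * spl + 1 / ((H : ℝ) ^ 4 * (1 + Real.log β) ^ 2) ≤ r → C * r * H ≤ 1 →
      0 ≤ s → s ≤ 1 / 100 → 17 * s ^ 2 ≤ spl ^ 2 → 17 * s ^ 2 ≤ spl' ^ 2 → 0 ≤ τ →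
      (∫ a in chartDomain H \ smallField H s, fpChartWeight β H r a ≤ τ * ∫ a in smallField H (s / 2), fpChartWeight β H r a) →
      ((boxState (fundamentalRep (Fin 2)) β H) {U | ¬ SmallPlaquettes H spl' U}).toReal ≤
        4 * Real.exp (-(c * (H : ℝ) ^ 4)) + 4 * ((boxState (fundamentalRep (Fin 2)) β H) {U | ¬ SmallPlaquettes H spl U}).toReal + 2 * τ :=
  boxState_not_smallPlaquettes_bootstrap_window stub_landauRepresentative

/-- ★ **Rarity bootstrap in the ✓T-S5.4J window, LINE-20 letters**: (i) from U2 `LandauRepresentativeBound` (premise `spl·H³·(1+log H) ≤ c₀`,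
radius `r₀ = √C_U2·H·(1+log H)·spl` — the START of the bootstrap is then compatible with the Gibbs bound `ε₀ > 2θ` for every `θ < 1/10`,
planner ym-idea-2 g18 22:16:43Z), (ii) from ✓`orbitNormaliserJacobianR`. -/
theorem boxState_not_smallPlaquettes_bootstrap_window_strong (hU2 : LandauRepresentativeBound) :
    ∃ K C c c₀ : ℝ, 0 < K ∧ 0 < C ∧ 0 < c ∧ 0 < c₀ ∧ ∀ H : ℕ, 1 ≤ H → ∀ (β spl spl' r s τ : ℝ), 2 ≤ β →
      C * (H : ℝ) ^ 12 * (1 + Real.log β) ^ 8 ≤ β → Real.exp (-(c * (H : ℝ) ^ 4)) ≤ 1 / 2 →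
      0 ≤ spl → spl * (H : ℝ) ^ 3 * (1 + Real.log H) ≤ c₀ →
      C * (K * H * (1 + Real.log H) * spl) * (H : ℝ) ^ 2 ≤ 1 →
      K * H * (1 + Real.log H) * spl + 1 / ((H : ℝ) ^ 4 * (1 + Real.log β) ^ 2) ≤ r → C * r * H ≤ 1 →
      0 ≤ s → s ≤ 1 / 100 → 17 * s ^ 2 ≤ spl ^ 2 → 17 * s ^ 2 ≤ spl' ^ 2 → 0 ≤ τ →
      (∫ a in chartDomain H \ smallField H s, fpChartWeight β H r a ≤ τ * ∫ a in smallField H (s / 2), fpChartWeight β H r a) →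
      ((boxState (fundamentalRep (Fin 2)) β H) {U | ¬ SmallPlaquettes H spl' U}).toReal ≤
        4 * Real.exp (-(c * (H : ℝ) ^ 4)) + 4 * ((boxState (fundamentalRep (Fin 2)) β H) {U | ¬ SmallPlaquettes H spl U}).toReal + 2 * τ := by
  obtain ⟨C₂, c₀, hC₂, hc₀, h2⟩ := hU2
  obtain ⟨C, c, hC, hc, hR⟩ := orbitNormaliserJacobianR
  refine ⟨Real.sqrt C₂, C, c, c₀, Real.sqrt_pos.2 hC₂, hC, hc, hc₀, ?_⟩
  intro H hH β spl spl' r s τ hβ hwin hδ hspl hprem hr₀C hgap hrC hs0 hs1 hspls hspls' hτ0 hτ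
  set r₀ : ℝ := Real.sqrt C₂ * H * (1 + Real.log H) * spl with hr₀
  have hHr : (1 : ℝ) ≤ (H : ℝ) := by exact_mod_cast hH
  have hlogH : 0 ≤ 1 + Real.log (H : ℝ) := by linarith [Real.log_nonneg hHr]
  have hr₀0 : 0 ≤ r₀ := by rw [hr₀]; positivity
  have hr₀sq : r₀ ^ 2 = C₂ * (H : ℝ) ^ 2 * (1 + Real.log H) ^ 2 * spl ^ 2 := by
    rw [hr₀]
    have := Real.sq_sqrt hC₂.le
    ring_nf
    rw [this]
    ring
  refine boxState_not_smallPlaquettes_bootstrap hH (r₀ := r₀) (by linarith) (Real.exp_pos _).le hδ ?_ ?_ hs0 hs1 hspls hspls' hτ0 hτ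
  · -- (i) the Landau representative from U2
    intro U hU hsp
    obtain ⟨g, hg, hL, hlinks⟩ := h2 H hH spl hspl hprem U hU hsp
    exact ⟨g, hg, hL, fun e he => (hlinks e he).trans_eq hr₀sq.symm⟩
  · -- (ii) the orbit-normaliser precision from T-S5.4J
    intro V hV hlinks
    exact hR H hH β r₀ r hβ hwin hr₀0 hr₀C hgap hrC V hV hlinks

/-- ★ **Rarity bootstrap, LINE-20 letters, unconditional structural input** (U2 = ✓`stub_landauRepresentativeStrong`). -/
theorem boxState_not_smallPlaquettes_bootstrap_window_strong' :
    ∃ K C c c₀ : ℝ, 0 < K ∧ 0 < C ∧ 0 < c ∧ 0 < c₀ ∧ ∀ H : ℕ, 1 ≤ H → ∀ (β spl spl' r s τ : ℝ), 2 ≤ β →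
      C * (H : ℝ) ^ 12 * (1 + Real.log β) ^ 8 ≤ β → Real.exp (-(c * (H : ℝ) ^ 4)) ≤ 1 / 2 →
      0 ≤ spl → spl * (H : ℝ) ^ 3 * (1 + Real.log H) ≤ c₀ →
      C * (K * H * (1 + Real.log H) * spl) * (H : ℝ) ^ 2 ≤ 1 →
      K * H * (1 + Real.log H) * spl + 1 / ((H : ℝ) ^ 4 * (1 + Real.log β) ^ 2) ≤ r → C * r * H ≤ 1 →
      0 ≤ s → s ≤ 1 / 100 → 17 * s ^ 2 ≤ spl ^ 2 → 17 * s ^ 2 ≤ spl' ^ 2 → 0 ≤ τ →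
      (∫ a in chartDomain H \ smallField H s, fpChartWeight β H r a ≤ τ * ∫ a in smallField H (s / 2), fpChartWeight β H r a) →
      ((boxState (fundamentalRep (Fin 2)) β H) {U | ¬ SmallPlaquettes H spl' U}).toReal ≤
        4 * Real.exp (-(c * (H : ℝ) ^ 4)) + 4 * ((boxState (fundamentalRep (Fin 2)) β H) {U | ¬ SmallPlaquettes H spl U}).toReal + 2 * τ :=
  boxState_not_smallPlaquettes_bootstrap_window_strong stub_landauRepresentativeStrong

end BoxToChart

end Summit.QuantumFields.YangMills.Theorems.AllWindowsColdBoxBoxHighLine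

end
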